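import Summits.ABC.ABC.Theorems.IneffectiveSubspaceUniformSadicTowerFourThreeSlotShapes

/-!
# `UniformSadicTowerFour` (stmt-ABC-14937), line `flat-steep-split` (lead c5): parity refinement
# of the rung-`3` shape trichotomy — the prime `2` is pinned in every shape

This file is the PARITY REFINEMENT of the structure theorem `boundedOmegaAt_three_iff_shapes` of
the first open rung `W = 3` of BoundedOmegaABC (abc with `C = C(ε)` on the cell `ω(abc) ≤ 3`,
`B₃`).  That theorem says `B₃` is abc, with the bound `c < C(ε) · (pqr)^(1+ε)`, on the three
exponential shapes over ALL primes `p, q, r` and ALL exponents `x, y, z ∈ ℕ`: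
(A) `1 + p^x q^y = r^z`, (B) `1 + p^x = q^y r^z`, (C) `p^x + q^y = r^z` with `p ≠ q`.
PARITY pins the prime `2`: in each shape one of `p, q, r` must be `2`, else the two sides of the
equation have different parity (powers and products of odd primes are odd, `p^0 = 1` included).
The theorem `boundedOmegaAt_three_iff_shapes_two` is the resulting by-name atlas index of the rung:
`B₃` is EQUIVALENT to abc on the six `2`-pinned families

* (A2) `1 + 2^x q^y = r^z`, (A2') `1 + p^x q^y = 2^z`,
* (B2) `1 + 2^x = q^y r^z` (Fermat / Mersenne-plus-one with two odd primes),
  (B2') `1 + p^x = 2^y r^z`,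
* (C2) `p^x + q^y = 2^z` with `p ≠ q` (Scott–Styer type),
  (C2') `2^x + q^y = r^z` with `q ≠ 2` (Ramanujan–Nagell / Lebesgue–Nagell / Catalan type).

**Proof.** (→) `boundedOmegaAt_three_iff_shapes.mp` gives the three unpinned shapes; each pinned
family is a specialisation (`p := 2`, `q := 2` or `r := 2`; the bounds are written `2qr`, `pq2`,
`p2r` so that no rewriting is needed).  (←) Each unpinned shape follows from its two pinned
families with the SUM of their constants: split on which of `p, q, r` is `2` (permuting the two
summands / factors by commutativity where the roles are exchanged), and if none is `2` the shape
equation is parity-impossible.  Then `boundedOmegaAt_three_iff_shapes.mpr`.  Also recorded: the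
elementary corner `shapeC_two_even_even` of (C2) — two odd prime powers with EVEN exponents sum to
a power of two only trivially (`1 + 1 = 2`), since odd squares are `≡ 1 (mod 8)`.

Sources: elementary parity [folklore]; the crux notes of the line
(`Cruxes/UniformSadicTowerFour/`).  Mathlib only (`Nat.Prime.odd_of_ne_two`, `Odd.pow`,
`Odd.mul`, `Odd.add_odd`, `Nat.pow_mod`, `omega`) and `boundedOmegaAt_three_iff_shapes`.  No new
definitions.  Deliberately NOT here: the rung `W = 3` itself (OPEN: abc at exponent `1 + ε` on each
of the six families is an open exponential Diophantine problem), the other stubs of the line.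
-/
noncomputable section

-- `Summit.<Summit>.<Problem>` is the mandated summit-side namespace (CONVENTIONS §2); for the
-- single-conjunct summit `ABC` the two coincide, so the duplicate `ABC.ABC` is deliberate.
set_option linter.dupNamespace false

namespace Summit.ABC.ABC.Theorems.UniformSadicTowerFour.BoundedOmega

open Literature.NumberTheory.DiophantineGeometry (IsABCTriple rad rad_def)

/-! ## Small helpers -/

/-- Monotonicity of the abc bound `C · R^(1+ε)` in the constant: from `c < C · R^(1+ε)` and
`C ≤ C'` follows `c < C' · R^(1+ε)`. [folklore] -/
private theorem bound_mono_const {c C C' ε : ℝ} {R : ℕ} (hCC : C ≤ C')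
    (h : c < C * (R : ℝ) ^ (1 + ε)) : c < C' * (R : ℝ) ^ (1 + ε) :=
  h.trans_le (mul_le_mul_of_nonneg_right hCC (Real.rpow_nonneg (Nat.cast_nonneg _) _))

/-- Parity of shape (A): `1 + p^x q^y = r^z` is impossible for three odd primes `p, q, r`
(`p^x q^y` and `r^z` are odd, `1 + odd` is even). [folklore] -/
private theorem shapeA_two_mem {p q r x y z : ℕ} (hp : p.Prime) (hq : q.Prime) (hr : r.Prime)
    (hE : 1 + p ^ x * q ^ y = r ^ z) (hp2 : p ≠ 2) (hq2 : q ≠ 2) : r = 2 := by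
  by_contra hr2
  have h1 : Odd (p ^ x * q ^ y) := (hp.odd_of_ne_two hp2).pow.mul (hq.odd_of_ne_two hq2).pow
  have h2 : Odd (r ^ z) := (hr.odd_of_ne_two hr2).pow
  rw [← hE] at h2
  exact Nat.not_even_iff_odd.2 h2 (odd_one.add_odd h1)

/-- Parity of shape (B): `1 + p^x = q^y r^z` is impossible for three odd primes `p, q, r`
(`1 + p^x` is even, `q^y r^z` is odd). [folklore] -/
private theorem shapeB_two_mem {p q r x y z : ℕ} (hp : p.Prime) (hq : q.Prime) (hr : r.Prime)
    (hE : 1 + p ^ x = q ^ y * r ^ z) (hp2 : p ≠ 2) (hq2 : q ≠ 2) : r = 2 := by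
  by_contra hr2
  have h1 : Even (1 + p ^ x) := odd_one.add_odd (hp.odd_of_ne_two hp2).pow
  have h2 : Odd (q ^ y * r ^ z) := (hq.odd_of_ne_two hq2).pow.mul (hr.odd_of_ne_two hr2).pow
  rw [← hE] at h2
  exact Nat.not_even_iff_odd.2 h2 h1

/-- Parity of shape (C): `p^x + q^y = r^z` is impossible for three odd primes `p, q, r`
(`odd + odd` is even, `r^z` is odd). [folklore] -/
private theorem shapeC_two_mem {p q r x y z : ℕ} (hp : p.Prime) (hq : q.Prime) (hr : r.Prime)
    (hE : p ^ x + q ^ y = r ^ z) (hp2 : p ≠ 2) (hq2 : q ≠ 2) : r = 2 := by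
  by_contra hr2
  have h1 : Even (p ^ x + q ^ y) := (hp.odd_of_ne_two hp2).pow.add_odd (hq.odd_of_ne_two hq2).pow
  rw [hE] at h1
  exact Nat.not_even_iff_odd.2 (hr.odd_of_ne_two hr2).pow h1

/-! ## An elementary corner of family (C2): even exponents -/

/-- An odd square is `≡ 1 (mod 8)`. [folklore] -/
private theorem sq_mod_eight_of_odd {m : ℕ} (hm : Odd m) : m ^ 2 % 8 = 1 := by
  have h : m % 8 = 1 ∨ m % 8 = 3 ∨ m % 8 = 5 ∨ m % 8 = 7 := by
    rw [Nat.odd_iff] at hm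
    omega
  rw [Nat.pow_mod]
  rcases h with h | h | h | h <;> simp [h]

/-- **Family (C2) with even exponents is trivial.** If `p, q` are odd primes, `x, y` are even and
`p^x + q^y = 2^z`, then `x = y = 0` and `z = 1` (`1 + 1 = 2`): odd squares are `≡ 1 (mod 8)`, so
`2^z ≡ 2 (mod 8)` forces `z = 1`, and then both prime powers equal `1`. [folklore] -/
theorem shapeC_two_even_even {p q x y z : ℕ} (hp : p.Prime) (hq : q.Prime) (hp2 : p ≠ 2)
    (hq2 : q ≠ 2) (hx : Even x) (hy : Even y) (h : p ^ x + q ^ y = 2 ^ z) :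
    x = 0 ∧ y = 0 ∧ z = 1 := by
  obtain ⟨k, rfl⟩ := hx
  obtain ⟨l, rfl⟩ := hy
  have hpk : p ^ (k + k) % 8 = 1 := by
    rw [← two_mul, pow_mul']
    exact sq_mod_eight_of_odd (hp.odd_of_ne_two hp2).pow
  have hql : q ^ (l + l) % 8 = 1 := by
    rw [← two_mul, pow_mul']
    exact sq_mod_eight_of_odd (hq.odd_of_ne_two hq2).pow
  have h2z : 2 ^ z % 8 = 2 := by omega
  have hz1 : z = 1 := by
    rcases Nat.lt_or_ge z 3 with hz | hz
    · interval_cases z <;> simp_all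
    · exfalso
      obtain ⟨w, rfl⟩ := Nat.exists_eq_add_of_le hz
      have h8 : 2 ^ (3 + w) = 8 * 2 ^ w := by rw [pow_add]; norm_num
      rw [h8, Nat.mul_mod_right] at h2z
      exact absurd h2z (by decide)
  subst hz1
  have h1p := Nat.one_le_pow (k + k) p hp.pos
  have h1q := Nat.one_le_pow (l + l) q hq.pos
  have hpe : p ^ (k + k) = 1 := by omega
  have hqe : q ^ (l + l) = 1 := by omega
  rw [pow_eq_one_iff] at hpe hqe
  have := hp.one_lt
  have := hq.one_lt
  omega

/-! ## The stub: `B₃ ⟺` abc on the six `2`-pinned families -/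

/-- **boundedOmegaAt_three_iff_shapes_two (atlas index of the first open rung `W = 3` of
BoundedOmegaABC).** abc with `C = C(ε)` on the cell `ω(abc) ≤ 3` holds iff abc holds, with the
bound `c < C(ε) · (pqr)^(1+ε)` over the three prime bases, on each of the six `2`-pinned exponential
families (A2) `1 + 2^x q^y = r^z`, (A2') `1 + p^x q^y = 2^z`, (B2) `1 + 2^x = q^y r^z`,
(B2') `1 + p^x = 2^y r^z`, (C2) `p^x + q^y = 2^z` (`p ≠ q`), (C2') `2^x + q^y = r^z` (`q ≠ 2`).
(→) Specialise the three shapes of `boundedOmegaAt_three_iff_shapes` at `2`.  (←) In each shape one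
of the three primes is `2` by parity (`shapeA_two_mem`, `shapeB_two_mem`, `shapeC_two_mem`), so the
shape follows from its two pinned families with the sum of their constants. [folklore] -/
theorem boundedOmegaAt_three_iff_shapes_two :
    (∀ ε : ℝ, 0 < ε → ∃ C : ℝ, 0 < C ∧ ∀ a b c : ℕ, IsABCTriple a b c →
      (a * b * c).primeFactors.card ≤ 3 → (c : ℝ) < C * ((rad a b c : ℕ) : ℝ) ^ (1 + ε)) ↔
    ((∀ ε : ℝ, 0 < ε → ∃ C : ℝ, 0 < C ∧ ∀ q r x y z : ℕ, q.Prime → r.Prime →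
        1 + 2 ^ x * q ^ y = r ^ z → ((r ^ z : ℕ) : ℝ) < C * ((2 * q * r : ℕ) : ℝ) ^ (1 + ε)) ∧
     (∀ ε : ℝ, 0 < ε → ∃ C : ℝ, 0 < C ∧ ∀ p q x y z : ℕ, p.Prime → q.Prime →
        1 + p ^ x * q ^ y = 2 ^ z → ((2 ^ z : ℕ) : ℝ) < C * ((p * q * 2 : ℕ) : ℝ) ^ (1 + ε)) ∧
     (∀ ε : ℝ, 0 < ε → ∃ C : ℝ, 0 < C ∧ ∀ q r x y z : ℕ, q.Prime → r.Prime →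
        1 + 2 ^ x = q ^ y * r ^ z →
          ((q ^ y * r ^ z : ℕ) : ℝ) < C * ((2 * q * r : ℕ) : ℝ) ^ (1 + ε)) ∧
     (∀ ε : ℝ, 0 < ε → ∃ C : ℝ, 0 < C ∧ ∀ p r x y z : ℕ, p.Prime → r.Prime →
        1 + p ^ x = 2 ^ y * r ^ z →
          ((2 ^ y * r ^ z : ℕ) : ℝ) < C * ((p * 2 * r : ℕ) : ℝ) ^ (1 + ε)) ∧
     (∀ ε : ℝ, 0 < ε → ∃ C : ℝ, 0 < C ∧ ∀ p q x y z : ℕ, p.Prime → q.Prime → p ≠ q →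
        p ^ x + q ^ y = 2 ^ z → ((2 ^ z : ℕ) : ℝ) < C * ((p * q * 2 : ℕ) : ℝ) ^ (1 + ε)) ∧
     (∀ ε : ℝ, 0 < ε → ∃ C : ℝ, 0 < C ∧ ∀ q r x y z : ℕ, q.Prime → r.Prime → 2 ≠ q →
        2 ^ x + q ^ y = r ^ z → ((r ^ z : ℕ) : ℝ) < C * ((2 * q * r : ℕ) : ℝ) ^ (1 + ε))) := by
  refine boundedOmegaAt_three_iff_shapes.trans ⟨fun ⟨hA, hB, hC⟩ => ?_, fun H => ?_⟩
  · -- (→): specialise the three shapes at the prime `2`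
    refine ⟨fun ε hε => ?_, fun ε hε => ?_, fun ε hε => ?_, fun ε hε => ?_, fun ε hε => ?_,
      fun ε hε => ?_⟩
    · obtain ⟨C, hC0, h⟩ := hA ε hε
      exact ⟨C, hC0, fun q r x y z hq hr hE => h 2 q r x y z Nat.prime_two hq hr hE⟩
    · obtain ⟨C, hC0, h⟩ := hA ε hε
      exact ⟨C, hC0, fun p q x y z hp hq hE => h p q 2 x y z hp hq Nat.prime_two hE⟩
    · obtain ⟨C, hC0, h⟩ := hB ε hε
      exact ⟨C, hC0, fun q r x y z hq hr hE => h 2 q r x y z Nat.prime_two hq hr hE⟩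
    · obtain ⟨C, hC0, h⟩ := hB ε hε
      exact ⟨C, hC0, fun p r x y z hp hr hE => h p 2 r x y z hp Nat.prime_two hr hE⟩
    · obtain ⟨C, hC0, h⟩ := hC ε hε
      exact ⟨C, hC0, fun p q x y z hp hq hpq hE => h p q 2 x y z hp hq Nat.prime_two hpq hE⟩
    · obtain ⟨C, hC0, h⟩ := hC ε hε
      exact ⟨C, hC0, fun q r x y z hq hr h2q hE => h 2 q r x y z Nat.prime_two hq hr h2q hE⟩
  · -- (←): in each shape one of the three primes is `2`
    obtain ⟨hA2, hA2', hB2, hB2', hC2, hC2'⟩ := H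
    refine ⟨fun ε hε => ?_, fun ε hε => ?_, fun ε hε => ?_⟩
    · -- shape (A) from (A2) and (A2')
      obtain ⟨C₁, hC₁, h₁⟩ := hA2 ε hε
      obtain ⟨C₂, hC₂, h₂⟩ := hA2' ε hε
      refine ⟨C₁ + C₂, by linarith, fun p q r x y z hp hq hr hE => ?_⟩
      rcases eq_or_ne p 2 with rfl | hp2
      · exact bound_mono_const (by linarith) (h₁ q r x y z hq hr hE)
      rcases eq_or_ne q 2 with rfl | hq2
      · rw [Nat.mul_comm p 2]
        exact bound_mono_const (by linarith) (h₁ p r y x z hp hr (by rwa [Nat.mul_comm] at hE))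
      obtain rfl : r = 2 := shapeA_two_mem hp hq hr hE hp2 hq2
      exact bound_mono_const (by linarith) (h₂ p q x y z hp hq hE)
    · -- shape (B) from (B2) and (B2')
      obtain ⟨C₁, hC₁, h₁⟩ := hB2 ε hε
      obtain ⟨C₂, hC₂, h₂⟩ := hB2' ε hε
      refine ⟨C₁ + C₂, by linarith, fun p q r x y z hp hq hr hE => ?_⟩
      rcases eq_or_ne p 2 with rfl | hp2
      · exact bound_mono_const (by linarith) (h₁ q r x y z hq hr hE)
      rcases eq_or_ne q 2 with rfl | hq2
      · exact bound_mono_const (by linarith) (h₂ p r x y z hp hr hE)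
      obtain rfl : r = 2 := shapeB_two_mem hp hq hr hE hp2 hq2
      rw [Nat.mul_comm (q ^ y) (2 ^ z), Nat.mul_right_comm p q 2]
      exact bound_mono_const (by linarith) (h₂ p q x z y hp hq (by rwa [Nat.mul_comm] at hE))
    · -- shape (C) from (C2) and (C2')
      obtain ⟨C₁, hC₁, h₁⟩ := hC2 ε hε
      obtain ⟨C₂, hC₂, h₂⟩ := hC2' ε hε
      refine ⟨C₁ + C₂, by linarith, fun p q r x y z hp hq hr hpq hE => ?_⟩
      rcases eq_or_ne p 2 with rfl | hp2
      · exact bound_mono_const (by linarith) (h₂ q r x y z hq hr hpq hE)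
      rcases eq_or_ne q 2 with rfl | hq2
      · rw [Nat.mul_comm p 2]
        exact bound_mono_const (by linarith)
          (h₂ p r y x z hp hr hpq.symm (by rwa [Nat.add_comm] at hE))
      obtain rfl : r = 2 := shapeC_two_mem hp hq hr hE hp2 hq2
      exact bound_mono_const (by linarith) (h₁ p q x y z hp hq hpq hE)

end Summit.ABC.ABC.Theorems.UniformSadicTowerFour.BoundedOmega

end
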